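import Summits.Schanuel.Schanuel.Theorems.RootDecomp1KDarkKernel
import Summits.Schanuel.Schanuel.Theorems.RootDecomp1KTHLayerCell01
import Summits.Schanuel.Schanuel.Theorems.RootDecomp1KGeneric16
import Literature.NumberTheory.Transcendental.LindemannWeierstrassProofs

/-!
# RootDecomp1KDarkLogSq — lens 6, generation 19 «DARK LOG-SQUARE KERNEL ⇒ THE POSITIVE-ORDER LAYER F₊ OF 33364 IS CLOSED AT n = 2» (K-R27 (F₊) lane; input NW96 Thm 1 BY NAME) — part 1 (RootDecomp1KDarkLogSq01): §1 `LogSqMeasure` + private Mahler-measure helpers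

PORT NOTE (census-1 gen 17, 2026-08-31): port of [HOME/decomp-schanuel-lens-6/g19/DarkLogSq.lean sha256 81ff816b…, 1170 l, imports TREE only (DarkKernel + THLayerCell01 + Generic16 + Literature LindemannWeierstrassProofs) + DLprobe + DLctrl + NODE-g19.md; CLAIM L1899, critic ACK + GRADING FRAME G19 L1903, NODE L1934 / REQUEST L1935, critic VERDICT L1938 (crit g8: CLEARED — K-R27 (F₊) ONE CELL CREDIT AWARDED to lens-6 g19; kernel VARIANT-ENGINE; (R2) residual of record at n = 2 := «(t, ρt), ρ Liouville ∧ ¬LogHyperLiouville» BOOKED; PORT GO)]; own farm rc 0 · 0 warn · 0 sorry · axioms std.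
Split in six parts for the 400-line cap: 01 = §1 `LogSqMeasure` + two private Mahler-measure helpers; 02 = §1 THE DARK KERNEL AT LOG-SQUARE QUALITY `logSqMeasure_of_int_relation'` (g10 binders verbatim ⟹ `LogSqMeasure t`; VARIANT-ENGINE of the tree `weakMeasure_of_int_relation'`; `maxHeartbeats 800000 in` carried as in the tree original); 03 = §1 tail (`logSqMeasure_of_dep`, `transcendental_of_logSqMeasure`) + §2 `logPowMeasure_one_of_logSqMeasure`, `logPowMeasure_of_dep`, `logPowMeasure_of_dark` (⟹ literally the TREE class `LogPowMeasure ![t]`, k = 2) + §3 THE CELL `sb_two_of_logHyperRatio`, `sb_two_logHyperPair`; 04 = §4 the positive-order layer at level 2 (`logHyperLiouville_of_liouvilleOrder`, `exists_logHyperLiouville_ratio_of_not_technicalHypothesis`, HEADLINE `posLayer_two_of_NW`, `item33364_two_logHyperClass`, `item33364_two_of_thLayer_two`, `item33364_two_of_underTH_two`) + §5 the residual-shrink certificate `sb_two_of_logFloorResidual`; 05 = §6 scope certificates and the two NAMED MEMBERS at the dark scale `tΩ` (`zA` ratio `ℓ_T`, `zB` ratio `towerNumber 4`) with typed non-membership.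 06 = §P (PORT per the VERDICT: the HOME probe's `section Probe` with every `example` turned into a named `probe_P…` theorem — the `n = 2` slices and the LIVE read-backs P0–P7, incl. P2′ `h33364 2 z hz hL hH = item33364_two_logHyperClass hNW z hz hL hH hcls := rfl`; imports tree `RootDecomp1KTHLayerCell05`, hence the ONLY part with the route-file cone).
PORT EDITS: `set_option linter.dupNamespace false` dropped; fifteen one-line docstrings; statements and proofs verbatim; the 35 `#guard_msgs` axiom guards stay in the HOME probe. `--supports stmt-Schanuel-33364`; no census credit carried; nothing here proves Schanuel or 33364; rung 0. The lens's header follows.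
-/

/-!
# RootDecomp1KDarkLogSq — lens 6, generation 19 «DARK LOG-SQUARE KERNEL ⇒ LEVEL 2 OF 33364 AT EVERY COMPLEX SCALE
# DOWN TO THE LOG-POWER FLOOR» (route-Schanuel-RootDecomp1K, item stmt-Schanuel-33364 `FiniteOrderLiouvilleSchanuel`; K-R27 (F₊) lane)

HOME-only kernel of the decomposition cell `decomp-schanuel` (NOTE/CLAIM STATUS L1899).  Nothing here proves Schanuel; rung 0.
Sorry-free; standard axioms; no `instance`, no `notation`; imports TREE files only.

## What is new (one sentence)
The lineage's dark-point kernel `HyperCell.weakMeasure_of_int_relation'` (TREE `RootDecomp1KDarkKernel` l.61, lens 6 g10) concludes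
only `WeakMeasure t` — `|P(t)| ≥ exp(−C·(len P)²)` — because its bookkeeping bounds `log Λ ≤ Λ` (ll. 269–286: `haΛ : a ≤ a1·Λ`, `hbΛ : b ≤ 2Λ` via `Real.log Λ ≤ Λ`); the SAME derivation from
Nesterenko–Waldschmidt 1996 Theorem 1 gives the LOG-SQUARE quality `|P(t)| ≥ exp(−C_d·(1 + log len P)²)` (§1, `logSqMeasure_of_int_relation'`),
so every exponential-algebraic point `t` (transcendental `t` with `t, e^t` algebraically dependent — logarithms of algebraic numbers included)
carries the TREE class `LogPowMeasure ![t]` (§2) and pairs, through the TREE principle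
`RootDecomp1KRelLiouvilleCell.sb_of_logHyperLiouville_of_logPowMeasure`, with every LOG-HYPER-Liouville ratio (§3): Schanuel's bound holds at
`(t, ρt)` for EVERY `t ≠ 0` and EVERY log-hyper-Liouville `ρ`, modulo NW96 Theorem 1 ALONE — level 2 of item 33364 on the whole
positive-order layer F₊ (exponential order `≥ 1`, §4) and beyond, at arbitrary complex scale, where the residual of record was
«`ρ` of NO exponential order 49» (TREE `RootDecomp1KGeneric.sb_two_of_lowOrderResidual`, critic VERDICT L1409 (4)).  New residual of record at
`n = 2`: «`ρ` Liouville, NOT log-hyper-Liouville» (§5, `sb_two_of_logFloorResidual`); it still contains `(ℓ_b, ℓ_b²)`.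
HEADLINE CELL (§4, `posLayer_two_of_NW`): the `n = 2` instance of the TREE layer `RootDecomp1KTHLayer.PosLayer` (item 33364 restricted to
the tuples VIOLATING Diaz's (T.H.), i.e. F₊) is a THEOREM mod NW96 Thm 1 — a pair that violates (T.H.) has a log-hyper-Liouville ratio
(`exists_logHyperLiouville_ratio_of_not_technicalHypothesis`, hypothesis-free) — so at `n = 2` item 33364 reduces to its (T.H.)-layer F₀
(`item33364_two_of_thLayer_two`).
NAMED MEMBERS (§6, hypothesis-free certificates) at the DARK scale `t_Ω = Ω` (`Ω·e^Ω = 1`, `Ω` transcendental by the TREE-proved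
Hermite–Lindemann `SumForm_holds`, `(Ω, e^Ω)` algebraically dependent): `z_A = (Ω, ℓ_T·Ω)` (ratio of exponential order 0, log-hyper,
NOT of order 12) and `z_B = (Ω, T₄·Ω)`, `T₄ = towerNumber 4` (exponential order 3, NOT 5; `z_B` violates (T.H.)): both in the scope of
item 33364 (LI, `LinLiouville`, `¬HyperLinLiouville` proved), both outside every tree cell (dark scale `t_Ω`: transcendental, `e^{t_Ω}` transcendental, not a fixed point of `exp`,
`(t_Ω, e^{t_Ω})` dependent — so no anchored/`W`-cell, no log-cell or Kummer-cell, no `Radical` fixed-point cell, no generic cell at coordinate 0;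
ratio not hyper: no `DarkHyperPair`; ratio of no order 49: no `ordCell`), both decided here (`sb_zA`, `sb_zB`, mod NW96 Thm 1).
PRIOR TREE CONTENT AT DEPENDENT POINTS (honesty): measures of log-power TYPE at SPECIAL dependent points already exist in the tree, all mod NW96
Thm 1 and all obtained through Fel'dman's transference `transcendenceMeasure_of_approximationMeasure` — Lang finite transcendence type `τ = 11` at
the FIXED POINTS of `exp` (`RootDecomp1KRadical05.finiteTranscendenceType_fixpoint`, lens 6 g11) and finite type at LOGARITHMS of algebraic numbers
(`RootDecomp1KKummerClosure05`) — but they are stated in the class `RootDecomp1KRadical.FiniteTranscendenceType`, feed only HYPER-Liouville cells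
(`hyperCell_fixpoint_any`, the Kummer log-cells), and were never bridged to `LogPowMeasure`; at a GENERAL exponential-algebraic point the tree has only
`WeakMeasure` (g10 dark kernel).  What is new is the log-power measure (exponent `k = 2`, uniform in the degree) at EVERY exponential-algebraic point,
read straight off the relation (no transference), typed IN the class `LogPowMeasure ![t]` and therefore paired with LOG-HYPER ratios by the TREE principle.
INPUT of record: `Literature.NumberTheory.Transcendental.NesterenkoWaldschmidt1996_thm_1` (FACT grade, hypothesis `hNW` as everywhere in
the 1K tree); nothing else.  HONEST SCOPE: the kernel §1 is a RE-SCALING of the g10 engine (K-R27′: VARIANT-ENGINE expected for §1); the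
claim of this generation is the CELL §3–§4 and the members §6; `n = 3` line cells are untouched (the tree's triple engine
`RootDecomp1KGeneric.ordCell_any` stays at order 49); the log-square quality is used only down to LOG-HYPER ratios (the LogPow principle's
reach) — a log-square ratio class would need a new class principle and is NOT claimed.
-/

noncomputable section

open Complex IntermediateField Filter Polynomial
open Literature.NumberTheory.Transcendental (NesterenkoWaldschmidt1996_thm_1)
open Summit.Schanuel.Schanuel.Theorems.RootDecomp1KHyper
open Summit.Schanuel.Schanuel.Theorems.RootDecomp1KHyper.HyperCell
open Summit.Schanuel.Schanuel.Theorems.RootDecomp1KGeneric (LiouvilleOrder LogSqLiouville sb_two_of_ordRatio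
  sb_two_of_lowOrderResidual)
open Summit.Schanuel.Schanuel.Theorems.RootDecomp1KRelLiouvilleCell

namespace Summit.Schanuel.Schanuel.Theorems.RootDecomp1KDarkLogSq

/-! ## §1. The dark kernel at log-square quality -/

/-- **Log-square transcendence measure** of a complex number `t`: for every degree `d` a constant `C` with
`|P(t)| ≥ exp(−C·(1 + log len P)²)` for all non-zero `P ∈ ℤ[X]` of degree `≤ d`.  (Compare the TREE classes:
`WeakMeasure` = `exp(−C·(len P)^k)`, `PolyMeasure` = `(len P)^{−τ}/C`; this one sits strictly between.) -/
def LogSqMeasure (t : ℂ) : Prop :=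
  ∀ d : ℕ, ∃ C : ℝ, 0 < C ∧ ∀ P : ℤ[X], P ≠ 0 → P.natDegree ≤ d →
    Real.exp (-(C * (1 + Real.log ((len P : ℤ) : ℝ)) ^ 2)) ≤ ‖aeval t P‖

/-- `1 ≤ M(R)` for a non-zero integer polynomial `R` (Mahler measure over `ℂ`). -/
private theorem one_le_mahlerMeasure_map_of_ne_zero {R : ℤ[X]} (hR : R ≠ 0) :
    1 ≤ (R.map (Int.castRingHom ℂ)).mahlerMeasure := by
  refine one_le_mahlerMeasure_of_one_le_norm_leadingCoeff ?_
  rw [Polynomial.leadingCoeff_map_of_injective (RingHom.injective_int _), eq_intCast,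
    Complex.norm_intCast]
  exact_mod_cast Int.one_le_abs (Polynomial.leadingCoeff_ne_zero.mpr hR)

end Summit.Schanuel.Schanuel.Theorems.RootDecomp1KDarkLogSq

end
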